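import Summits.QuantumFields.YangMills.Theorems.BalabanUVNodesN09TowerChartOfPerBondChartsAtRecord
import Summits.QuantumFields.YangMills.Theorems.BalabanUVNodesN09TowerConfinementOfPerBondCharts
import Summits.QuantumFields.YangMills.Theorems.BalabanUVNodesN09TowerBasePointOfPerBondCharts
import Summits.QuantumFields.YangMills.Theorems.BalabanUVNodesN09FibreThresholdNullOfCharts
import Summits.QuantumFields.YangMills.Theorems.BalabanUVNodesN09RegularityTowerOfGeometricChartData

/-!
# NODE N09 [B12] — ROAD A′ RUNS dag-n09-w1's (F1) REGULARITY TOWER: N09's analytic inclusion `hreg_j` and (F3)_j for all `j < K` from per-bond inversions of the (0.4) averages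
# in the private coordinates at the central `α`-windows — the STATUS THEOREM of the private-coordinate road, with exactly four a.e.∕pointwise continuity sockets left displayed

Cell `pub-ymgap` (YM-PLAN Track A), width seat `pub-ymgap-dag-n09-w5` g4 (D-0154 ∕ R399 (3a) width seat 5 of node N09), FILE 6; helper of K1⁹
`StabilityBRunRowsAtRecordR13SepCoPHV` = stmt-QuantumFields-27364 (`--supports`, `--as helper`, count-neutral).  [I] = [Balaban1987RG1] (CMP 109).

WHAT.  dag-n09-w1 g5's `…N09RegularityTowerOfGeometricChartData.hreg_pos_all_of_geometricChartData` (p622064) at the road-A′ instance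
`(Z j, τ j, Φ j, J j, z₀ j) := (GaugeField (F.P K) j (SU N), fieldMeasure, Φ′_j, J′_j, V^{(j)})` of FILES 2–5 (`…N09TowerChartOfPerBondCharts[AtRecord]`,
`…N09TowerConfinementOfPerBondCharts`, `…N09TowerBasePointOfPerBondCharts`) and dag-n09-w3 g5's `…N09FibreThresholdNullOfCharts.hnull_towerChart_of_perBondCharts` (p625076):
the sockets `hΦ hJ havgΦ hmap hconf hnull hz₀` are theorems of — per step `j < K` — per-bond inversion data of the one-variable (0.4) averages at the CENTRAL `α`-WINDOWS
(`T ϑ jd` with `hTm hθm hjm hright hlaw hleft`, the windows' measurability `hΩm` and blindness `hΩbl`, a uniform bound `jd ≤ B`), [B11]-existence `hsolν`, N07's continuity `hcrit`,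
(H-U) `hU`, (I19) `hint`, and numerics; what STAYS DISPLAYED of the tower's regularity is EXACTLY `hΦV hJV hΦc hJpos` at `(Φ′, J′)` — the one-bond inverse as a function of the
environment (joint continuity ∕ parametric openness), the located residue of the road.

WHAT IS PROVED (theorems only; 0 def, 0 instance, 0 notation, 0 sorry).  §1 `measurable_extend_centralBond` · `measurableSet_rebaseSet_all` · ★ `measurable_towerChart_all` (the
tower's `hΦ`∕`hJ` at EVERY level — no injectivity of `β` needed); §2 ★★★ `hreg_pos_all_of_perBondCharts_centralWindow` — `∀ j < K, domAlt_{j+1} ⊆ regSetOfRecord K j ρ_j ∧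
∀ V ∈ domAlt_{j+1}, 0 < TcanOfRecord K j ρ_j V` (`ρ_j` the β-input with the (2.9) species at `θ₀.ν, θ₀.ε₂₉`), from the data above.

HONEST FRAMING.  A COMPOSITION BY NAME (count-neutral); the four continuity sockets, the per-bond inversion data, `hcrit` ([B11] Thm 1 for a continuous selector), `hsolν`, `hU`, `hint`
and the numerics stay DISPLAYED hypotheses, asserted of NO record; NO Jacobian law proved; NOTHING of Bałaban's proved or denied; `hreg` RE-SHAPED (now: per-bond inversions + four
continuity sockets + N07 + numerics), NOT discharged; N09 NOT discharged; conjunct 1 (Lemma 4) and FLAG №7 untouched; K0⁷ ∕ K1⁹ ∕ K3⁸ NOT closed; counts unmoved (typed 28∕28 ·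
discharged 5∕28); no summit statement is proved by this seat; one finite four-torus programme at fixed `ε = L^{−K}` per run — R4 closes the conditional rung `BalabanLadder.UV` only; NOT
continuum ∕ ℝ⁴ ∕ infinite volume ∕ OS; the Yang–Mills mass gap (Clay) is NOT proved by any of this.
-/

noncomputable section

namespace Summit.QuantumFields.YangMills.BalabanUVNodes.N09TowerOfPerBondCharts

open MeasureTheory Set Function Filter Topology
open scoped ENNReal NNReal
open Literature.MathematicalPhysics.QuantumFieldTheory.Balaban1983to89
open Literature.MathematicalPhysics.QuantumFieldTheory.Balaban1983to89.T4Continuum (T4Family)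
open Literature.MathematicalPhysics.QuantumFieldTheory.Balaban1983to89.Node00
open Literature.MathematicalPhysics.QuantumFieldTheory.Balaban1983to89.ExpMeanLog (deltaSU)
open Literature.MathematicalPhysics.QuantumFieldTheory.Balaban1983to89.FederbushMean (deltaFed)
open Literature.MathematicalPhysics.QuantumFieldTheory.Balaban1983to89.BlockAveraging (Idx loopHol)
open Literature.MathematicalPhysics.QuantumFieldTheory.Balaban1983to89.BlockAveragingHaarAC (centralBond pre post)
open Literature.MathematicalPhysics.QuantumFieldTheory.Balaban1983to89.BlockAveragingEMLHaarAC (fibreFamily)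
open N09HregOfPerBondChartsAtRecord (measurable_triJacobian_record)
open N09TowerChartOfPerBondChartsAtRecord (tower_havgΦ_of_perBondCharts_of_hsolν tower_hmap_of_perBondCharts_of_hsolν_of_numerics)
open N09TowerConfinementOfPerBondCharts (tower_hconf_of_perBondCharts_of_hsolν_of_numerics)
open N09TowerBasePointOfPerBondCharts (tower_hz0_of_perBondCharts_of_hsolν_of_numerics)
open N09FibreThresholdNullOfCharts (hnull_towerChart_of_perBondCharts)
open N09RegularityTowerOfGeometricChartData (hreg_pos_all_of_geometricChartData)

variable {F : T4Family} {N : ℕ} [NeZero N]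

/-! ## §1  Measurability of the re-based chart at EVERY level (the tower asks `hΦ`, `hJ` for all `j`, not only `j < K`; no injectivity of `β` is needed) -/

section AllLevels

variable {K j : ℕ} (T : PBond (F.P K) (j + 1) → GaugeField (F.P K) j (SU N) → Set (SU N))
  (ϑ : PBond (F.P K) (j + 1) → GaugeField (F.P K) j (SU N) → SU N → SU N)
  (jd : PBond (F.P K) (j + 1) → GaugeField (F.P K) j (SU N) → SU N → ℝ≥0)

omit [NeZero N] in
/-- Road A′'s chart is jointly measurable at every level (bondwise: either a local inverse read at a chosen preimage, or the untouched coordinate — `Function.extend_def`).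
[cite: Balaban1987RG1, (2.10) p.267 (bookkeeping)] -/
theorem measurable_extend_centralBond (hθm : ∀ c, Measurable fun p : GaugeField (F.P K) j (SU N) × SU N => ϑ c p.1 p.2) :
    Measurable fun p : ((PBond (F.P K) (j + 1) → SU N) × GaugeField (F.P K) j (SU N)) => (extend centralBond (fun c => ϑ c p.2 (p.1 c)) p.2 : GaugeField (F.P K) j (SU N)) := by
  refine measurable_pi_iff.2 fun b => ?_
  by_cases hb : ∃ c, centralBond c = b
  · have h : (fun p : ((PBond (F.P K) (j + 1) → SU N) × GaugeField (F.P K) j (SU N)) => (extend centralBond (fun c => ϑ c p.2 (p.1 c)) p.2 : GaugeField (F.P K) j (SU N)) b) =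
        fun p => ϑ (Classical.choose hb) p.2 (p.1 (Classical.choose hb)) := by
      funext p; rw [Function.extend_def, dif_pos hb]
    rw [h]
    exact (hθm (Classical.choose hb)).comp (measurable_snd.prodMk ((measurable_pi_apply (Classical.choose hb)).comp measurable_fst))
  · have h : (fun p : ((PBond (F.P K) (j + 1) → SU N) × GaugeField (F.P K) j (SU N)) => (extend centralBond (fun c => ϑ c p.2 (p.1 c)) p.2 : GaugeField (F.P K) j (SU N)) b) = fun p => p.2 b := by
      funext p; rw [Function.extend_def, dif_neg hb]
    rw [h]
    exact (measurable_pi_apply b).comp measurable_snd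

/-- The record rebase set is measurable at every level ((H-U) `hU`). [cite: Balaban1987RG1, (2.9) p.266 and (2.10) p.267 (bookkeeping)] -/
theorem measurableSet_rebaseSet_all (ν : Stage7Numerics) (ε₁ : ℝ) (g : ℕ → ℝ)
    (hTm : ∀ c, MeasurableSet {p : GaugeField (F.P K) j (SU N) × SU N | p.2 ∈ T c p.1})
    (hθm : ∀ c, Measurable fun p : GaugeField (F.P K) j (SU N) × SU N => ϑ c p.1 p.2)
    (hjm : ∀ c, Measurable fun p : GaugeField (F.P K) j (SU N) × SU N => jd c p.1 p.2) (hU : ∀ k, Measurable (Uk F N K (k + 1) ν.εreg)) :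
    MeasurableSet {p : ((PBond (F.P K) (j + 1) → SU N) × GaugeField (F.P K) j (SU N)) | ({q : ((PBond (F.P K) (j + 1) → SU N) × GaugeField (F.P K) j (SU N)) | ∀ c, q.1 c ∈ T c q.2}.indicator fun q => ∏ c, jd c q.2 (q.1 c)) p ≠ 0 ∧
      (extend centralBond (fun c => ϑ c p.2 (p.1 c)) p.2 : GaugeField (F.P K) j (SU N)) ∈ {U : GaugeField (F.P K) j (SU N) | chiFixed29 F N ν ε₁ K g j U ≠ 0}} :=
  ((measurable_triJacobian_record T jd hTm hjm) (measurableSet_singleton (0 : ℝ≥0)).compl).inter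
    (measurable_extend_centralBond ϑ hθm ((measurable_chiFixed29_of ε₁ hU g j) (measurableSet_singleton (0 : ℝ)).compl))

/-- ★ The re-based chart `Φ′` is measurable at EVERY level. [cite: Balaban1987RG1, (2.3) p.265 and (2.10) p.267 (bookkeeping)] -/
theorem measurable_towerChart_all (ν : Stage7Numerics) (ε₁ : ℝ) (g : ℕ → ℝ)
    (hTm : ∀ c, MeasurableSet {p : GaugeField (F.P K) j (SU N) × SU N | p.2 ∈ T c p.1})
    (hθm : ∀ c, Measurable fun p : GaugeField (F.P K) j (SU N) × SU N => ϑ c p.1 p.2)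
    (hjm : ∀ c, Measurable fun p : GaugeField (F.P K) j (SU N) × SU N => jd c p.1 p.2) (hU : ∀ k, Measurable (Uk F N K (k + 1) ν.εreg))
    [DecidablePred (· ∈ {p : ((PBond (F.P K) (j + 1) → SU N) × GaugeField (F.P K) j (SU N)) | ({q : ((PBond (F.P K) (j + 1) → SU N) × GaugeField (F.P K) j (SU N)) | ∀ c, q.1 c ∈ T c q.2}.indicator fun q => ∏ c, jd c q.2 (q.1 c)) p ≠ 0 ∧
      (extend centralBond (fun c => ϑ c p.2 (p.1 c)) p.2 : GaugeField (F.P K) j (SU N)) ∈ {U : GaugeField (F.P K) j (SU N) | chiFixed29 F N ν ε₁ K g j U ≠ 0}})] :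
    Measurable fun p : ((PBond (F.P K) (j + 1) → SU N) × GaugeField (F.P K) j (SU N)) =>
      Set.piecewise {p : ((PBond (F.P K) (j + 1) → SU N) × GaugeField (F.P K) j (SU N)) | ({q : ((PBond (F.P K) (j + 1) → SU N) × GaugeField (F.P K) j (SU N)) | ∀ c, q.1 c ∈ T c q.2}.indicator fun q => ∏ c, jd c q.2 (q.1 c)) p ≠ 0 ∧
          (extend centralBond (fun c => ϑ c p.2 (p.1 c)) p.2 : GaugeField (F.P K) j (SU N)) ∈ {U : GaugeField (F.P K) j (SU N) | chiFixed29 F N ν ε₁ K g j U ≠ 0}}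
        (fun p => (extend centralBond (fun c => ϑ c p.2 (p.1 c)) p.2 : GaugeField (F.P K) j (SU N))) (fun p => critCfgOfRecord F N ν K j p.1) p :=
  Measurable.piecewise (measurableSet_rebaseSet_all T ϑ jd ν ε₁ g hTm hθm hjm hU) (measurable_extend_centralBond ϑ hθm)
    ((measurable_critCfgOfRecord_of (hU j)).comp measurable_fst)

end AllLevels

/-! ## §2  Road A′ runs the tower -/

/-- ★★★ **ROAD A′ RUNS THE (F1) REGULARITY TOWER.**  At a Stage-13 parameter `θ₀`, torus `K`, history `g`, radius `α`: given per step `j < K` per-bond inversion data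
`(T j, ϑ j, jd j)` of the one-variable (0.4) averages at the central `α`-windows — coarse windows jointly measurable (`hTm`), inverses and inverse densities jointly measurable
(`hθm`, `hjm`), right inverse on the coarse window (`hright`), the inverse change-of-variables law of one-bond Haar measure (`hlaw`), the left-inverse clause on the fine window
(`hleft`), the windows' joint measurability (`hΩm`) and blindness to the private coordinates (`hΩbl`), a uniform bound `jd ≤ B` — and the four DISPLAYED continuity sockets of
dag-n09-w1's tower at the re-based chart `(Φ′, J′)` (`hΦV hJV`: a.e.-`U` continuity in the coarse field within the domain; `hΦc hJpos`: continuity ∕ positivity at the base point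
`V^{(j)}(V)`), [B11]-existence `hsolν`, N07's `hcrit`, (H-U) `hU`, (I19) `hint` and numerics (`0 < ε₂₉`, dag-n09-w4 g3's seven, `hord`, `(((d+2)L)²∕4)·ε₀ ≤ α`, `0 ≤ ε₀`,
`((d·L)²∕4)·ε₀ < δ_Fed`): for every `j < K`, `domAlt_{j+1} ⊆ regSetOfRecord K j ρ_j` (N09's `hreg_j`) and `T_jρ_j > 0` on `domAlt_{j+1}` ((F3)_j).  A composition BY NAME of
p622064 with FILES 2–5 and p625076; CONDITIONAL; nothing of Bałaban's asserted; `hreg` NOT discharged.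
[cite: Balaban1987RG1, p.259, (0.4) p.253, (0.19) p.255, (2.3)–(2.4) pp.265–266 and (2.9)–(2.10) pp.266–267; Balaban1985Averaging, Prop. 2 (53) p.26; Balaban1985Variational, Thm 1 (8)–(10) p.279] -/
theorem hreg_pos_all_of_perBondCharts_centralWindow (θ₀ : Stage13Params F N) (K : ℕ) (g : ℕ → ℝ) [∀ j, DecidableEq (PBond (F.P K) j)] {α : ℝ}
    (T : ∀ j, PBond (F.P K) (j + 1) → GaugeField (F.P K) j (SU N) → Set (SU N))
    (ϑ : ∀ j, PBond (F.P K) (j + 1) → GaugeField (F.P K) j (SU N) → SU N → SU N)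
    (jd : ∀ j, PBond (F.P K) (j + 1) → GaugeField (F.P K) j (SU N) → SU N → ℝ≥0)
    (hΩm : ∀ j < K, ∀ c : PBond (F.P K) (j + 1),
      MeasurableSet {p : GaugeField (F.P K) j (SU N) × SU N | ∀ i : Idx (F.P K), dist1 (fibreFamily p.1 c (pre p.1 c * p.2 * post p.1 c) i) ≤ α})
    (hTm : ∀ j c, MeasurableSet {p : GaugeField (F.P K) j (SU N) × SU N | p.2 ∈ T j c p.1})
    (hθm : ∀ j c, Measurable fun p : GaugeField (F.P K) j (SU N) × SU N => ϑ j c p.1 p.2)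
    (hjm : ∀ j c, Measurable fun p : GaugeField (F.P K) j (SU N) × SU N => jd j c p.1 p.2)
    (hΩbl : ∀ j < K, ∀ (c : PBond (F.P K) (j + 1)) (U : GaugeField (F.P K) j (SU N)) (g' : PBond (F.P K) (j + 1) → SU N),
      {g : SU N | ∀ i : Idx (F.P K), dist1 (fibreFamily (extend centralBond g' U) c
          (pre (extend centralBond g' U) c * g * post (extend centralBond g' U) c) i) ≤ α} =
        {g : SU N | ∀ i : Idx (F.P K), dist1 (fibreFamily U c (pre U c * g * post U c) i) ≤ α})
    (hright : ∀ j < K, ∀ c U, ∀ v ∈ T j c U, (avOfRecord F N K j).avg (update U (centralBond c) (ϑ j c U v)) c = v)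
    (hlaw : ∀ j < K, ∀ (c : PBond (F.P K) (j + 1)) (U : GaugeField (F.P K) j (SU N)),
      (HaarData.haar : Measure (SU N)).restrict {g : SU N | ∀ i : Idx (F.P K), dist1 (fibreFamily U c (pre U c * g * post U c) i) ≤ α} =
        (((HaarData.haar : Measure (SU N)).restrict (T j c U)).withDensity fun v => (jd j c U v : ℝ≥0∞)).map (ϑ j c U))
    (hleft : ∀ j < K, ∀ (c : PBond (F.P K) (j + 1)) (U : GaugeField (F.P K) j (SU N)) (g' : SU N),
      (∀ i : Idx (F.P K), dist1 (fibreFamily U c (pre U c * g' * post U c) i) ≤ α) →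
        ϑ j c U ((avOfRecord F N K j).avg (update U (centralBond c) g') c) = g')
    {B : ℝ≥0} (hjdB : ∀ j < K, ∀ c U v, jd j c U v ≤ B)
    (hεreg : 0 < θ₀.ν.εreg)
    (hε3 : (143 * (((((F.P K).d + 4 : ℕ) : ℝ)) ^ 2 / 4) ^ 2) * θ₀.ν.εreg ≤ 1 / 3)
    (hε2 : 2 * θ₀.ν.εreg ≤ 2 * deltaSU (Fin N) / ((((F.P K).d + 4) * (F.P K).L : ℕ) : ℝ) ^ 2) (hε29 : 0 < θ₀.ε₂₉)
    (hn1 : 1640 * (2 * (((((F.P K).d + 2) * (F.P K).L : ℕ) : ℝ) * θ₀.ε₂₉) +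
        ((((F.P K).d + 2) * (F.P K).L : ℕ) : ℝ) ^ 2 / 4 * (2 * θ₀.ν.εreg / ((F.P K).L : ℝ) ^ 2)) * (((F.P K).L : ℝ) ^ ((F.P K).d - 1)) ^ 2 ≤ 1)
    (hn2 : 13 * (2 * (((((F.P K).d + 2) * (F.P K).L : ℕ) : ℝ) * θ₀.ε₂₉) +
        ((((F.P K).d + 2) * (F.P K).L : ℕ) : ℝ) ^ 2 / 4 * (2 * θ₀.ν.εreg / ((F.P K).L : ℝ) ^ 2)) * ((F.P K).L : ℝ) ^ ((F.P K).d - 1) < deltaSU (Fin N))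
    (hord : 2 * θ₀.ν.εreg / ((F.P K).L : ℝ) ^ 2 +
      4 * max θ₀.ε₂₉ (10 * (((((F.P K).d + 2) * (F.P K).L : ℕ) : ℝ) * θ₀.ε₂₉) * ((F.P K).L : ℝ) ^ ((F.P K).d - 1)) ≤ θ₀.ν.ε₀)
    (hα : ((((F.P K).d + 2) * (F.P K).L : ℕ) : ℝ) ^ 2 / 4 * θ₀.ν.ε₀ ≤ α)
    (hε₀ : 0 ≤ θ₀.ν.ε₀) (hnumF : ((((F.P K).d * (F.P K).L : ℕ) : ℝ)) ^ 2 / 4 * θ₀.ν.ε₀ < deltaFed (Fin N))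
    (hsolν : ∀ j < K, ∀ W ∈ domAltOfRecord F N θ₀.ν K (j + 1), UkExists F N K (j + 1) θ₀.ν.εreg W)
    (hU : ∀ k, Measurable (Uk F N K (k + 1) θ₀.ν.εreg))
    (hint : ∀ j < K, Integrable (betaInputOfRecord F N (TcanOfRecord F N) (chiFixed29 F N θ₀.ν θ₀.ε₂₉) K g j) (fieldMeasure (F.P K) j (SU N)))
    (hcrit : ∀ j < K, ContinuousOn (critCfgOfRecord F N θ₀.ν K j) (domAltOfRecord F N θ₀.ν K (j + 1)))
    [∀ j, DecidablePred (· ∈ {p : ((PBond (F.P K) (j + 1) → SU N) × GaugeField (F.P K) j (SU N)) |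
          ({q : ((PBond (F.P K) (j + 1) → SU N) × GaugeField (F.P K) j (SU N)) | ∀ c, q.1 c ∈ T j c q.2}.indicator fun q => ∏ c, jd j c q.2 (q.1 c)) p ≠ 0 ∧
            (extend centralBond (fun c => ϑ j c p.2 (p.1 c)) p.2 : GaugeField (F.P K) j (SU N)) ∈
              {U : GaugeField (F.P K) j (SU N) | chiFixed29 F N θ₀.ν θ₀.ε₂₉ K g j U ≠ 0}})]
    (hΦV : ∀ j < K, ∀ V₀ ∈ domAltOfRecord F N θ₀.ν K (j + 1), ∀ᵐ z ∂(fieldMeasure (F.P K) j (SU N)),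
      ContinuousWithinAt (fun V => (Set.piecewise {p : ((PBond (F.P K) (j + 1) → SU N) × GaugeField (F.P K) j (SU N)) |
          ({q : ((PBond (F.P K) (j + 1) → SU N) × GaugeField (F.P K) j (SU N)) | ∀ c, q.1 c ∈ T j c q.2}.indicator fun q => ∏ c, jd j c q.2 (q.1 c)) p ≠ 0 ∧
            (extend centralBond (fun c => ϑ j c p.2 (p.1 c)) p.2 : GaugeField (F.P K) j (SU N)) ∈
              {U : GaugeField (F.P K) j (SU N) | chiFixed29 F N θ₀.ν θ₀.ε₂₉ K g j U ≠ 0}}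
        (fun p => (extend centralBond (fun c => ϑ j c p.2 (p.1 c)) p.2 : GaugeField (F.P K) j (SU N)))
        (fun p => critCfgOfRecord F N θ₀.ν K j p.1)) (V, z)) (domAltOfRecord F N θ₀.ν K (j + 1)) V₀)
    (hJV : ∀ j < K, ∀ V₀ ∈ domAltOfRecord F N θ₀.ν K (j + 1), ∀ᵐ z ∂(fieldMeasure (F.P K) j (SU N)),
      ContinuousWithinAt (fun V => (((Set.indicator {p : ((PBond (F.P K) (j + 1) → SU N) × GaugeField (F.P K) j (SU N)) |
          ({q : ((PBond (F.P K) (j + 1) → SU N) × GaugeField (F.P K) j (SU N)) | ∀ c, q.1 c ∈ T j c q.2}.indicator fun q => ∏ c, jd j c q.2 (q.1 c)) p ≠ 0 ∧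
            (extend centralBond (fun c => ϑ j c p.2 (p.1 c)) p.2 : GaugeField (F.P K) j (SU N)) ∈
              {U : GaugeField (F.P K) j (SU N) | chiFixed29 F N θ₀.ν θ₀.ε₂₉ K g j U ≠ 0}}
        ({q : ((PBond (F.P K) (j + 1) → SU N) × GaugeField (F.P K) j (SU N)) | ∀ c, q.1 c ∈ T j c q.2}.indicator fun q => ∏ c, jd j c q.2 (q.1 c))) (V, z) : ℝ≥0) : ℝ)) (domAltOfRecord F N θ₀.ν K (j + 1)) V₀)
    (hΦc : ∀ j < K, ∀ V ∈ domAltOfRecord F N θ₀.ν K (j + 1),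
      ContinuousAt (fun z => (Set.piecewise {p : ((PBond (F.P K) (j + 1) → SU N) × GaugeField (F.P K) j (SU N)) |
          ({q : ((PBond (F.P K) (j + 1) → SU N) × GaugeField (F.P K) j (SU N)) | ∀ c, q.1 c ∈ T j c q.2}.indicator fun q => ∏ c, jd j c q.2 (q.1 c)) p ≠ 0 ∧
            (extend centralBond (fun c => ϑ j c p.2 (p.1 c)) p.2 : GaugeField (F.P K) j (SU N)) ∈
              {U : GaugeField (F.P K) j (SU N) | chiFixed29 F N θ₀.ν θ₀.ε₂₉ K g j U ≠ 0}}
        (fun p => (extend centralBond (fun c => ϑ j c p.2 (p.1 c)) p.2 : GaugeField (F.P K) j (SU N)))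
        (fun p => critCfgOfRecord F N θ₀.ν K j p.1)) (V, z)) (critCfgOfRecord F N θ₀.ν K j V))
    (hJpos : ∀ j < K, ∀ V ∈ domAltOfRecord F N θ₀.ν K (j + 1),
      ∀ᶠ z in 𝓝 (critCfgOfRecord F N θ₀.ν K j V), 0 < (Set.indicator {p : ((PBond (F.P K) (j + 1) → SU N) × GaugeField (F.P K) j (SU N)) |
          ({q : ((PBond (F.P K) (j + 1) → SU N) × GaugeField (F.P K) j (SU N)) | ∀ c, q.1 c ∈ T j c q.2}.indicator fun q => ∏ c, jd j c q.2 (q.1 c)) p ≠ 0 ∧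
            (extend centralBond (fun c => ϑ j c p.2 (p.1 c)) p.2 : GaugeField (F.P K) j (SU N)) ∈
              {U : GaugeField (F.P K) j (SU N) | chiFixed29 F N θ₀.ν θ₀.ε₂₉ K g j U ≠ 0}}
        ({q : ((PBond (F.P K) (j + 1) → SU N) × GaugeField (F.P K) j (SU N)) | ∀ c, q.1 c ∈ T j c q.2}.indicator fun q => ∏ c, jd j c q.2 (q.1 c))) (V, z)) :
    ∀ j < K, domAltOfRecord F N θ₀.ν K (j + 1) ⊆ regSetOfRecord F N K j
        (betaInputOfRecord F N (TcanOfRecord F N) (chiFixed29 F N θ₀.ν θ₀.ε₂₉) K g j) ∧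
      ∀ V ∈ domAltOfRecord F N θ₀.ν K (j + 1),
        0 < TcanOfRecord F N K j (betaInputOfRecord F N (TcanOfRecord F N) (chiFixed29 F N θ₀.ν θ₀.ε₂₉) K g j) V := by
  haveI : ∀ j, (fieldMeasure (F.P K) j (SU N)).IsOpenPosMeasure := fun j => isOpenPosMeasure_piHaar_SUN N (F.P K) j
  have hα' : ((((F.P K).d + 2) * (F.P K).L : ℕ) : ℝ) ^ 2 / 4 * (2 * θ₀.ν.εreg / ((F.P K).L : ℝ) ^ 2) ≤ α := by
    have hL0 : (0 : ℝ) < (F.P K).L := by exact_mod_cast (F.P K).L_pos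
    have h4 : 0 ≤ 4 * max θ₀.ε₂₉ (10 * (((((F.P K).d + 2) * (F.P K).L : ℕ) : ℝ) * θ₀.ε₂₉) * ((F.P K).L : ℝ) ^ ((F.P K).d - 1)) := mul_nonneg (by norm_num) (hε29.le.trans (le_max_left _ _))
    have hδε : 2 * θ₀.ν.εreg / ((F.P K).L : ℝ) ^ 2 ≤ θ₀.ν.ε₀ := by linarith
    exact (mul_le_mul_of_nonneg_left hδε (by positivity)).trans hα
  exact hreg_pos_all_of_geometricChartData (F := F) (N := N) θ₀.ν K g
    (Z := fun j => GaugeField (F.P K) j (SU N)) (τ := fun j => fieldMeasure (F.P K) j (SU N))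
    (Φ := fun j => fun p => (Set.piecewise {p : ((PBond (F.P K) (j + 1) → SU N) × GaugeField (F.P K) j (SU N)) |
          ({q : ((PBond (F.P K) (j + 1) → SU N) × GaugeField (F.P K) j (SU N)) | ∀ c, q.1 c ∈ T j c q.2}.indicator fun q => ∏ c, jd j c q.2 (q.1 c)) p ≠ 0 ∧
            (extend centralBond (fun c => ϑ j c p.2 (p.1 c)) p.2 : GaugeField (F.P K) j (SU N)) ∈
              {U : GaugeField (F.P K) j (SU N) | chiFixed29 F N θ₀.ν θ₀.ε₂₉ K g j U ≠ 0}}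
        (fun p => (extend centralBond (fun c => ϑ j c p.2 (p.1 c)) p.2 : GaugeField (F.P K) j (SU N)))
        (fun p => critCfgOfRecord F N θ₀.ν K j p.1)) p)
    (J := fun j => fun p => (Set.indicator {p : ((PBond (F.P K) (j + 1) → SU N) × GaugeField (F.P K) j (SU N)) |
          ({q : ((PBond (F.P K) (j + 1) → SU N) × GaugeField (F.P K) j (SU N)) | ∀ c, q.1 c ∈ T j c q.2}.indicator fun q => ∏ c, jd j c q.2 (q.1 c)) p ≠ 0 ∧
            (extend centralBond (fun c => ϑ j c p.2 (p.1 c)) p.2 : GaugeField (F.P K) j (SU N)) ∈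
              {U : GaugeField (F.P K) j (SU N) | chiFixed29 F N θ₀.ν θ₀.ε₂₉ K g j U ≠ 0}}
        ({q : ((PBond (F.P K) (j + 1) → SU N) × GaugeField (F.P K) j (SU N)) | ∀ c, q.1 c ∈ T j c q.2}.indicator fun q => ∏ c, jd j c q.2 (q.1 c))) p)
    (z₀ := fun j V => critCfgOfRecord F N θ₀.ν K j V)
    hε29 hε₀ hnumF hsolν hint
    (fun j => measurable_towerChart_all (T j) (ϑ j) (jd j) θ₀.ν θ₀.ε₂₉ g (hTm j) (hθm j) (hjm j) hU)
    (fun j => (measurable_triJacobian_record (T j) (jd j) (hTm j) (hjm j)).indicator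
      (measurableSet_rebaseSet_all (T j) (ϑ j) (jd j) θ₀.ν θ₀.ε₂₉ g (hTm j) (hθm j) (hjm j) hU))
    (fun j hj => tower_havgΦ_of_perBondCharts_of_hsolν (T j) (ϑ j) (jd j) θ₀.ν θ₀.ε₂₉ g hj (hright j hj) (hsolν j hj))
    (fun j hj => tower_hmap_of_perBondCharts_of_hsolν_of_numerics θ₀ K g hj (T j) (ϑ j) (jd j) (hΩm j hj) (hTm j) (hθm j) (hjm j)
      (hΩbl j hj) (hright j hj) (hlaw j hj) hU hεreg hε3 hε2 hε29.le hn1 hn2 hord hsolν hα)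
    (fun j hj => tower_hconf_of_perBondCharts_of_hsolν_of_numerics θ₀ K g hj (T j) (ϑ j) (jd j) (hright j hj) (hjdB j hj)
      hεreg hε3 hε2 hε29.le hn1 hn2 hord hsolν (hcrit j hj))
    hΦV hJV hcrit
    (hnull_towerChart_of_perBondCharts θ₀.ν K T ϑ jd hright (fun j => {p : ((PBond (F.P K) (j + 1) → SU N) × GaugeField (F.P K) j (SU N)) |
          ({q : ((PBond (F.P K) (j + 1) → SU N) × GaugeField (F.P K) j (SU N)) | ∀ c, q.1 c ∈ T j c q.2}.indicator fun q => ∏ c, jd j c q.2 (q.1 c)) p ≠ 0 ∧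
            (extend centralBond (fun c => ϑ j c p.2 (p.1 c)) p.2 : GaugeField (F.P K) j (SU N)) ∈
              {U : GaugeField (F.P K) j (SU N) | chiFixed29 F N θ₀.ν θ₀.ε₂₉ K g j U ≠ 0}}) (fun j _ p hp => hp.1) hsolν hε29)
    (fun j hj => tower_hz0_of_perBondCharts_of_hsolν_of_numerics θ₀ K g hj (T j) (ϑ j) (jd j) (hleft j hj) hεreg hε3 hε2 hα' hsolν)
    hΦc hJpos

end Summit.QuantumFields.YangMills.BalabanUVNodes.N09TowerOfPerBondCharts

end
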